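import Summits.BirchSwinnertonDyer.Rank1Residual.Additive.ZpTowerUnramifiedLayer
import Summits.BirchSwinnertonDyer.Rank1Residual.Additive.AdditiveTamagawaWitnessBaseChange
import Summits.BirchSwinnertonDyer.Rank1Residual.Additive.SplitMultiplicativeBaseChange
import Summits.BirchSwinnertonDyer.Rank1Residual.Additive.SplitMultiplicativeWitnessNoRootsOfUnity
import HarnessLib

/-!
# The Tamagawa witnesses of the budget programme at the places of a layer `ℚ_n`, from data over
# `ℚ` (row T-E3g-BUDn-CERT, FILE 2a: the layer witnesses; seat p10 GEN 5 — FILE 1 = n1011-p01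
# GEN 3, assembly = FILE 2b `BudgetFromTamagawaCertificatesLayer`)

HONEST FRAMING (cell `b2b-bsdres`, run/shared/lean/b2b/bsd-rank1-residual/, verbatim in every
file): the goal of the cell is to DELETE the COMBINATION-SHAPED residual classes of the
Birch–Swinnerton-Dyer formula for ALL analytic-rank `≤ 1` elliptic curves over `ℚ` — "full BSD
formula for every rank `≤ 1` curve in class `C`" assembled STRICTLY from published theorems — so
that the rank-`≤ 1` remainder becomes exactly the CONSTRUCTION-SHAPED classes, which are TYPED
(missing-input `Prop`s), NOT attempted. This is not "finishing BSD". Team n1011 (N10/N11, the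
Route-G LOWER budget node of the CONSTRUCTION-SHAPED classes X3♯/X4♯): research route; nothing is
booked by this file; no mark / label moved. THEOREMS ONLY: no definition, no named fact, no
`sorry`.

## What (ROUTE-2 II.17.3 D-n.2 / D-n.3 at the layers; p10 GEN 4 HANDOFF item N4)

Row T-E3g-BUDn's `budgetLeLambdaAt_layer_of_tamagawaWitnesses` (N2) wants, over the layer
`ℚ_n = κ.layer n`, places `w ∤ p` carrying `∃ u ∈ H¹_ur((ℚ_n)_w, E[p]), u ∉ 𝓚_w` for `E ⊗ ℚ_n`.
THIS FILE produces them at every `w ∣ v` from data at the place `v` of the BASE field only: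

* §1 `exists_mem_unramifiedSubgroup_not_mem_kummerLocalConditionAt_layer_of_hasAdditiveReductionAt`
  — `K` any number field, ANY `ℤ_p`-extension `κ`, `v ∤ p`, `p` odd, `E` additive at `v`,
  `p ∣ c_v(E/K)` (n1011-p06 FILE F `…_baseChange_of_dvd_localTamagawaNumber`, its `he` discharged
  by n1011-p06 FILE G `ZpTower.ramificationIdxIn_layer_eq_one`);
* §2 bookkeeping `ℓ ∈ w`, `p ∉ w` for `w ∣ v`;
* §3 `…_layer_of_hasSplitMultiplicativeReductionAtPrime` — `E/ℚ` globally minimal, split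
  multiplicative at the prime `ℓ ≠ p`, `v ∋ ℓ`, `p ∣ c_v`, granted Tate's uniformisation (named
  fact A40, hypothesis `hU`, applied over `(ℚ_n)_w` itself) and `μ_p((ℚ_n)_w) = 1` (hypothesis
  `hμ`; FILE 1 (n1011-p01) derives it from `ℓ ≢ 1 (mod p)`): n1011-p16 FILE 6 (split
  multiplicative reduction persists at `w`) + n1011-p06 (C)/(E) (a nonzero `p`-torsion point of
  `E(ℚ_v)` from `p ∣ c_v`, pushed to `E((ℚ_n)_w)`) + n1011-p16
  `…_of_tateData_of_point_of_forall_pow_eq_one`.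

HONEST LIMITS: split multiplicative `ℓ ≡ 1 (mod p)` rows are NOT covered (they need (L1),
n1011-p14); non-split multiplicative `ℓ` never has `p ∣ c_ℓ` for odd `p`; no Tamagawa persistence
under base change is used anywhere (the point is transported instead).

References: R. Greenberg, LNM 1716 (1999) §2 p. 74, §5 (406D1) [GreenbergLNM1716]; J. H. Silverman,
*ATAEC* V.3, V.5 [SilvermanATAEC1994], *AEC* VII.5–6 [SilvermanAEC2009]; L. C. Washington,
*Introduction to Cyclotomic Fields* Prop. 13.2 [Washington1997]; ROUTE-2 II.17 (cells/n1011/).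
-/


set_option autoImplicit false

noncomputable section

open scoped Classical

open Function Field NumberField IsDedekindDomain WeierstrassCurve
open Literature.NumberTheory.EllipticCurves Literature.NumberTheory.GaloisRepresentations
open Literature.NumberTheory.GaloisRepresentations.DiscreteGaloisModule (unramifiedSubgroup)
open Literature.NumberTheory.GaloisCohomology

namespace Summit.BirchSwinnertonDyer.Rank1Residual.Additive

/-! ### §1 The additive layer witness -/

section AdditiveWitness

variable {K : Type} [Field K] [NumberField K] (W : WeierstrassCurve K) [W.IsElliptic] {p : ℕ}
  [hp : Fact p.Prime] (κ : ZpExtension K p) (n : ℕ)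

/-- **The additive Tamagawa witness at the places of a layer `K_n`.** For `E = W` over a number
field `K`, ANY `ℤ_p`-extension `κ`, a level `n`, a finite place `v ∤ p` of `K` with `p` odd, `E`
additive at `v` and `p ∣ c_v(E/K)`, and every place `w ∣ v` of `K_n = κ.layer n`:
`∃ u ∈ H¹_ur((K_n)_w, E[p]), u ∉ 𝓚_w` for `E ⊗ K_n` (n1011-p06
`…_baseChange_of_dvd_localTamagawaNumber`, its unramifiedness hypothesis `he` being
`ZpTower.ramificationIdxIn_layer_eq_one`). [cite: GreenbergLNM1716, §2 p. 74 and §5 (406D1)]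
[cite: Washington1997, Prop. 13.2] -/
theorem exists_mem_unramifiedSubgroup_not_mem_kummerLocalConditionAt_layer_of_hasAdditiveReductionAt
    {v : HeightOneSpectrum (𝓞 K)} (hpv : ((p : ℕ) : 𝓞 K) ∉ v.asIdeal) (hp2 : p ≠ 2)
    (hadd : W.HasAdditiveReductionAt v)
    (hc : p ∣ (W.baseChange (v.adicCompletion K)).localTamagawaNumber (v.adicCompletionIntegers K))
    (w : HeightOneSpectrum (𝓞 (κ.layer n))) (hw : w.under (𝓞 K) = v) :
    ∃ u ∈ unramifiedSubgroup
        (((W.baseChange (κ.layer n)).torsionGaloisModule (p : ℤ)).restrictField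
          (w.adicCompletion (κ.layer n))) 1,
      u ∉ (W.baseChange (κ.layer n)).kummerLocalConditionAt (p : ℤ)
        (w.adicCompletion (κ.layer n)) :=
  exists_mem_unramifiedSubgroup_not_mem_kummerLocalConditionAt_baseChange_of_dvd_localTamagawaNumber
    W p (κ.layer n) (congrArg HeightOneSpectrum.asIdeal hw)
    (ZpTower.ramificationIdxIn_layer_eq_one κ n hpv) hpv hp2 hadd hc

end AdditiveWitness

/-! ### §2 Places above a place (bookkeeping) -/

section Places

variable {p : ℕ}

/-- `ℓ ∈ w` for a place `w` of an extension above the place `v ∋ ℓ` of `ℚ`. [folklore] -/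
theorem natCast_mem_asIdeal_of_under_eq {L : Type*} [Field L] [NumberField L]
    {v : HeightOneSpectrum (𝓞 ℚ)} {ℓ : ℕ} (hℓv : ((ℓ : ℕ) : 𝓞 ℚ) ∈ v.asIdeal)
    (w : HeightOneSpectrum (𝓞 L)) (hw : w.under (𝓞 ℚ) = v) : ((ℓ : ℕ) : 𝓞 L) ∈ w.asIdeal := by
  have h : ((ℓ : ℕ) : 𝓞 ℚ) ∈ w.asIdeal.under (𝓞 ℚ) := by
    rw [← HeightOneSpectrum.under_asIdeal, hw]; exact hℓv
  rw [Ideal.mem_under, map_natCast] at h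
  exact h

/-- `p ∉ w` for a place `w` of an extension above a place `v ∌ p`. [folklore] -/
theorem natCast_not_mem_asIdeal_of_under_eq {K L : Type*} [Field K] [NumberField K] [Field L]
    [NumberField L] [Algebra K L] {v : HeightOneSpectrum (𝓞 K)}
    (hpv : ((p : ℕ) : 𝓞 K) ∉ v.asIdeal) (w : HeightOneSpectrum (𝓞 L)) (hw : w.under (𝓞 K) = v) :
    ((p : ℕ) : 𝓞 L) ∉ w.asIdeal := fun h ↦ hpv (by
  rw [← hw, HeightOneSpectrum.under_asIdeal, Ideal.mem_under, map_natCast]; exact h)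

end Places

/-! ### §3 The split-multiplicative layer witness (mod A40) -/

section SplitWitness

variable (V : WeierstrassCurve ℚ) [V.IsElliptic] [V.IsGloballyMinimal] {p : ℕ} [hp : Fact p.Prime]
  (κ : ZpExtension ℚ p) (n : ℕ)

/-- **The split-multiplicative Tamagawa witness at the places of `ℚ_n`, modulo A40.** For
`E = V/ℚ` globally minimal with split multiplicative reduction at the prime `ℓ ≠ p`, the place
`v ∋ ℓ` with `p ∣ c_v`, ANY `ℤ_p`-extension `κ` of `ℚ`, a level `n` and a place `w ∣ v` of
`ℚ_n = κ.layer n` whose completion has no non-trivial `p`-th root of unity (`hμ`; FILE 1 derives it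
from `ℓ ≢ 1 (mod p)`): granted Tate's uniformisation (`hU`, applied over `(ℚ_n)_w`),
`∃ u ∈ H¹_ur((ℚ_n)_w, E[p]), u ∉ 𝓚_w` for `E ⊗ ℚ_n` — split multiplicative reduction persists at
`w` (n1011-p16 FILE 6), a nonzero `p`-torsion point of `E(ℚ_v)` (`p ∣ c_v`, n1011-p06 (C)) is
pushed to `E((ℚ_n)_w)` (n1011-p06 (E)), and n1011-p16's
`…_of_tateData_of_point_of_forall_pow_eq_one` concludes. CONDITIONAL on A40 (`hU`).
DOMINATED TWIN (referee 1 GEN 16 FLAG-2, lead R5-57 (e)): row T-L1-KN's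
`exists_mem_unramifiedSubgroup_not_mem_kummerLocalConditionAt_baseChange_of_split_of_dvd_localTamagawaNumber'`
(`SplitMultiplicativeWitnessOfTamagawa`) gives the same witness at EVERY split place from `p ∣ c_v`
modulo A40 with NO `hμ`; that form is the statement of record
(`BudgetFromTamagawaCertificatesLayerAll`), this one is kept for its lighter import cone.
[cite: SilvermanATAEC1994, Ch. V Thm. 3.1 (c),(d) and Thm. 5.3 (a),(b)]
[cite: GreenbergLNM1716, §3 p. 74 and Cor. 5.6 (proof)] -/
theorem exists_mem_unramifiedSubgroup_not_mem_kummerLocalConditionAt_layer_of_hasSplitMultiplicativeReductionAtPrime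
    (hU : Silverman1994_thmV53_tateUniformisation.{0}) {ℓ : ℕ} [hℓ : Fact ℓ.Prime]
    {v : HeightOneSpectrum (𝓞 ℚ)} (hℓv : ((ℓ : ℕ) : 𝓞 ℚ) ∈ v.asIdeal) (hne : ℓ ≠ p)
    (hsplit : V.HasSplitMultiplicativeReductionAtPrime ℓ)
    (hc : p ∣ (V.baseChange (v.adicCompletion ℚ)).localTamagawaNumber (v.adicCompletionIntegers ℚ))
    (w : HeightOneSpectrum (𝓞 (κ.layer n))) (hw : w.under (𝓞 ℚ) = v)
    (hμ : ∀ ζ : w.adicCompletion (κ.layer n), ζ ^ p = 1 → ζ = 1) :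
    ∃ u ∈ unramifiedSubgroup
        (((V.baseChange (κ.layer n)).torsionGaloisModule (p : ℤ)).restrictField
          (w.adicCompletion (κ.layer n))) 1,
      u ∉ (V.baseChange (κ.layer n)).kummerLocalConditionAt (p : ℤ)
        (w.adicCompletion (κ.layer n)) := by
  haveI : (V.baseChange (κ.layer n)).IsElliptic := by rw [baseChange]; infer_instance
  haveI : w.asIdeal.LiesOver v.asIdeal := ⟨(congrArg HeightOneSpectrum.asIdeal hw).symm⟩
  have hpv : ((p : ℕ) : 𝓞 ℚ) ∉ v.asIdeal :=
    HeightOneSpectrum.natCast_not_mem_asIdeal_of_prime_mem hℓv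
      (fun h ↦ hne ((Nat.prime_dvd_prime_iff_eq hℓ.out hp.out).mp h))
  have hpw : ((p : ℕ) : 𝓞 (κ.layer n)) ∉ w.asIdeal := natCast_not_mem_asIdeal_of_under_eq hpv w hw
  -- split multiplicative reduction persists at `w`; Tate data over `(ℚ_n)_w`
  have hsplitw : (V.baseChange (κ.layer n)).HasSplitMultiplicativeReductionAt w :=
    hasSplitMultiplicativeReductionAt_baseChange_of_hasSplitMultiplicativeReductionAtPrime V ℓ w
      (natCast_mem_asIdeal_of_under_eq hℓv w hw) hsplit
  obtain ⟨q, Φ, hq0, hq1, hsurj, hker, hequiv, hrat⟩ := hU (V.baseChange (κ.layer n)) w hsplitw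
  -- a nonzero `p`-torsion point over `ℚ_v`, pushed to `(ℚ_n)_w`
  obtain ⟨T, hT, hpT⟩ := exists_point_ne_zero_zsmul_eq_zero_of_dvd_localTamagawaNumber V p v hpv hc
  obtain ⟨T', hT', hpT'⟩ :=
    exists_point_ne_zero_zsmul_eq_zero_baseChange_adicCompletion_of_liesOver V (κ.layer n) v w hT hpT
  exact (V.baseChange (κ.layer n)).exists_mem_unramifiedSubgroup_not_mem_kummerLocalConditionAt_of_tateData_of_point_of_forall_pow_eq_one
    w hpw hq0 hq1 Φ hsurj hker hequiv hrat hμ hT' hpT'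

end SplitWitness

end Summit.BirchSwinnertonDyer.Rank1Residual.Additive

end
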